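import Summits.Parity.GeneralizedHardyLittlewood.Theses.LiouvilleShiftedTables
import Summits.Parity.GeneralizedHardyLittlewood.Theorems.LiouvilleShiftedTablesDilatedTableChowlaStubSmallConductors
import Literature.NumberTheory.LFunctions.LiouvilleCharSumLinnikBox

/-!
# The generic core (C⁺) of `DilatedTableChowla` contains `TableChowla` (stmt-Parity-14270)

Support file for the crux `LiouvilleShiftedTables.DilatedTableChowla` (stmt-Parity-14271), line
`positivity-quarantine`, stub `stub_genericAffineTable` = (C⁺).  Certificate that (C⁺) is at least
as hard as the sibling crux: `tableChowla_of_genericAffineTable : (C⁺) → TableChowla`.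

At the dilation `q = 1` (never in the exceptional set `E'`, whose harmonic mass is `< 1`) the
one-point hypothesis of (C⁺) — `(log x)^B`-saving character sums of `λ` to all moduli
`n ≤ (log x)^κ` on `[1, y]`, `x^{1/2} ≤ y ≤ x²` — holds UNCONDITIONALLY for large `x`: every such
modulus is box-zero-free (landed stub (Z1) `SmallConductors.stub_smallConductors`: classical region +
Siegel) and box-zero-freeness gives the character-sum bound (tree
`Literature.NumberTheory.LFunctions.LiouvilleCharSumLinnikBox.norm_sum_le`, landed for stub (★));
and the conclusion of (C⁺) at `q = 1` (classes mod `1` are everything) is `TableChowla` verbatim.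
[folklore]
-/

namespace Summit.Parity.GeneralizedHardyLittlewood.Theorems.DilatedTableChowla.GenericCore

open Finset
open Summit.Parity.GeneralizedHardyLittlewood.Theses.LiouvilleShiftedTables

/-- Eventually `(log x)^κ ≤ x^{1/16}`. [folklore] -/
theorem eventually_log_rpow_le_rpow_sixteenth (κ : ℝ) :
    ∃ x₁ : ℝ, ∀ x : ℝ, x₁ ≤ x → Real.log x ^ κ ≤ x ^ (1 / 16 : ℝ) := by
  have hlo := isLittleO_log_rpow_rpow_atTop κ (by norm_num : (0 : ℝ) < 1 / 16)
  have hev := hlo.def zero_lt_one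
  obtain ⟨x₁, hx₁⟩ := Filter.eventually_atTop.1 hev
  refine ⟨max x₁ 1, fun x hx => ?_⟩
  have hx1 : x₁ ≤ x := le_trans (le_max_left _ _) hx
  have hx1' : 1 ≤ x := le_trans (le_max_right _ _) hx
  have h := hx₁ x hx1
  rw [Real.norm_of_nonneg (Real.rpow_nonneg (Real.log_nonneg hx1') κ),
    Real.norm_of_nonneg (Real.rpow_nonneg (by linarith) _), one_mul] at h
  exact h

/-- **(C⁺) contains the sibling crux.** `GenericAffineTable → TableChowla`: the registered stub
`stub_genericAffineTable` of the line `positivity-quarantine` (written out) implies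
`LiouvilleShiftedTables.TableChowla` (stmt-Parity-14270).  So (C⁺) is crux-sized: it is implied by
the crux (`genericAffineTable_of_dilatedTableChowla`) and implies the rank-2 crux of the same route.
[folklore] -/
theorem tableChowla_of_genericAffineTable
    (hG : ∀ c : ℤ, c ≠ 0 → ∀ δ : ℝ, 0 < δ → δ ≤ 1 / 12 → ∀ C : ℝ, 0 < C → ∃ B κ : ℝ, 0 < κ ∧
    ∃ x₀ : ℝ, ∀ x : ℝ, x₀ ≤ x → ∀ A : ℝ, x ^ δ ≤ A → A ≤ x ^ (1 / 3 + δ) → ∀ u v : ℕ → ℕ,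
      ∃ E' : Finset ℕ, (∑ q ∈ E', ((q : ℝ))⁻¹) ≤ (Real.log x ^ C)⁻¹ ∧
        ∀ q : ℕ, 1 ≤ q → q ≤ ⌊x ^ (δ / 2)⌋₊ → q ∉ E' →
          (∀ n : ℕ, q ∣ n → (n : ℝ) ≤ q * Real.log x ^ κ → ∀ [NeZero n],
            ∀ χ : DirichletCharacter ℂ n, ∀ y : ℝ, x ^ (1 / 2 : ℝ) ≤ y → y ≤ x ^ 2 →
              ‖∑ k ∈ Finset.Icc 1 ⌊y⌋₊, (ArithmeticFunction.liouville k : ℂ) * χ (k : ZMod n)‖ ≤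
                y / Real.log x ^ B) →
          (q : ℝ) ^ 4 *
            (∑ a ∈ (Finset.Ioc ⌊A⌋₊ ⌊2 * A⌋₊).filter (fun a : ℕ => a ≡ u q [MOD q]),
              ∑ a' ∈ (Finset.Ioc ⌊A⌋₊ ⌊2 * A⌋₊).filter (fun a' : ℕ => a' ≡ u q [MOD q]),
                (∑ b ∈ (Finset.Icc 1 ⌊x / A⌋₊).filter (fun b : ℕ => b ≡ v q [MOD q]),
                  (ArithmeticFunction.liouville (Int.toNat ((a : ℤ) * b + c)) : ℝ) *
                    (ArithmeticFunction.liouville (Int.toNat ((a' : ℤ) * b + c)) : ℝ)) ^ 2)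
            ≤ x ^ 2 / Real.log x ^ C) :
    TableChowla := by
  intro c hc δ hδ hδ' C hC
  obtain ⟨B, κ, _hκ, x₀, h⟩ := hG c hc δ hδ hδ' C hC
  obtain ⟨K', H, x₁, hLB⟩ :=
    Literature.NumberTheory.LFunctions.LiouvilleCharSumLinnikBox.norm_sum_le B
  obtain ⟨x₂, hZ1⟩ := SmallConductors.stub_smallConductors κ K' H
  obtain ⟨x₃, hx₃⟩ := eventually_log_rpow_le_rpow_sixteenth κ
  refine ⟨max (max x₀ x₁) (max x₂ (max x₃ (Real.exp 2))), fun x hx A hA1 hA2 => ?_⟩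
  have hx0 : x₀ ≤ x := le_trans (le_trans (le_max_left _ _) (le_max_left _ _)) hx
  have hx1 : x₁ ≤ x := le_trans (le_trans (le_max_right _ _) (le_max_left _ _)) hx
  have hx2 : x₂ ≤ x := le_trans (le_trans (le_max_left _ _) (le_max_right _ _)) hx
  have hx3 : x₃ ≤ x :=
    le_trans (le_trans (le_trans (le_max_left _ _) (le_max_right _ _)) (le_max_right _ _)) hx
  have hxe : Real.exp 2 ≤ x :=
    le_trans (le_trans (le_trans (le_max_right _ _) (le_max_right _ _)) (le_max_right _ _)) hx
  have hxpos : 0 < x := lt_of_lt_of_le (Real.exp_pos 2) hxe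
  have hx1' : 1 ≤ x := le_trans (by have := Real.add_one_le_exp (2 : ℝ); linarith) hxe
  have hL2 : 2 ≤ Real.log x := by
    rw [← Real.log_exp 2]; exact Real.log_le_log (Real.exp_pos 2) hxe
  have hLpos : 0 < Real.log x := by linarith
  have hLC1 : 1 < Real.log x ^ C := Real.one_lt_rpow (by linarith) hC
  -- (C⁺) at `x, A` with the constant class functions `0`
  obtain ⟨E', hE', hq⟩ := h x hx0 A hA1 hA2 (fun _ => 0) (fun _ => 0)
  -- `1 ∉ E'`
  have h1E : (1 : ℕ) ∉ E' := by
    intro h1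
    have hge : (1 : ℝ) ≤ ∑ q ∈ E', ((q : ℝ))⁻¹ := by
      have := Finset.single_le_sum (f := fun q : ℕ => ((q : ℝ))⁻¹) (fun q _ => by positivity) h1
      simpa using this
    have hlt : (Real.log x ^ C)⁻¹ < 1 := inv_lt_one_of_one_lt₀ hLC1
    linarith
  have hQ1 : 1 ≤ ⌊x ^ (δ / 2)⌋₊ :=
    Nat.le_floor (by simpa using Real.one_le_rpow hx1' (by linarith : 0 ≤ δ / 2))
  -- the one-point data at `q = 1` holds unconditionally
  have hone : ∀ n : ℕ, 1 ∣ n → (n : ℝ) ≤ ((1 : ℕ) : ℝ) * Real.log x ^ κ → ∀ [NeZero n],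
      ∀ χ : DirichletCharacter ℂ n, ∀ y : ℝ, x ^ (1 / 2 : ℝ) ≤ y → y ≤ x ^ 2 →
        ‖∑ k ∈ Finset.Icc 1 ⌊y⌋₊, (ArithmeticFunction.liouville k : ℂ) * χ (k : ZMod n)‖ ≤
          y / Real.log x ^ B := by
    intro n _ hnle _ χ y hy1 hy2
    rw [Nat.cast_one, one_mul] at hnle
    have hn16 : (n : ℝ) ≤ x ^ (1 / 16 : ℝ) := hnle.trans (hx₃ x hx3)
    exact hLB x hx1 n hn16 χ (fun z hz1 hz2 hz3 => hZ1 x hx2 n χ z hnle hz1 hz2 hz3) y hy1 hy2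
  have key := hq 1 le_rfl hQ1 h1E hone
  -- classes mod `1` are everything
  have hrow : (Finset.Ioc ⌊A⌋₊ ⌊2 * A⌋₊).filter (fun a : ℕ => a ≡ 0 [MOD 1]) =
      Finset.Ioc ⌊A⌋₊ ⌊2 * A⌋₊ := Finset.filter_true_of_mem fun a _ => Nat.modEq_one
  have hcol : (Finset.Icc 1 ⌊x / A⌋₊).filter (fun b : ℕ => b ≡ 0 [MOD 1]) = Finset.Icc 1 ⌊x / A⌋₊ :=
    Finset.filter_true_of_mem fun b _ => Nat.modEq_one
  simp only [Nat.cast_one, one_pow, one_mul] at key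
  rw [hrow, hcol] at key
  exact key

end Summit.Parity.GeneralizedHardyLittlewood.Theorems.DilatedTableChowla.GenericCore
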